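import Summits.QuantumFields.BalabanUV.Beta.AccretiveCombesThomas
import Summits.QuantumFields.BalabanUV.T4Continuum.Support.RegionGaugeSliceOrth

/-!
# `Summit.QuantumFields.BalabanUV.Beta.MultiscaleCombesThomas` — the SITE-LOCAL (multiscale) accretive
# Combes–Thomas bound: conjugated coercivity against a SITE-DEPENDENT mass profile `μ` (no global constant)
# gives invertibility and the entrywise bound `‖A⁻¹(i,j)‖ ≤ e^{−κ d(i,j)} / √(μ_i μ_j)` — exponential decay with
# LOCAL PREFACTORS (v1.0.1; file 1 of 2: the engine; file 2 `MultiscaleCombesThomasBudget` = the sitewise budget algebra,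
# the scale-adapted END and the real bridge)

HONEST FRAMING (page 1 of everything in this cell).  Discharging `FlowStep.BetaPertH` would make Bałaban's
ultraviolet stability UNCONDITIONAL — a constructive-QFT result; it is NOT the continuum limit and NOT the Clay
problem.  This module discharges nothing of `BetaPertH`; it is ELEMENTARY finite-dimensional linear algebra
([folklore]: the Combes–Thomas 1973 ∕ Agmon 1982 conjugation argument with a POSITION-DEPENDENT lower bound),
kernel-checked, written by the OWNER of binder row D4 (unit `b2b-balaban-beta-an4`, gen 42; claim
«MULTISCALE-CT-LOCAL», journal l.17755) for NODE O.2 item (v) «k-UNIFORM constants» of the owner's outline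
`beta/skeletons/D4-b2b-balaban-beta-an4.md` — the DECAY half.  HONEST DEPENDENCY: continuum YM on T⁴ ⇐ BetaPertH ∧
nine spine estimates (0/9 proved); BetaPertH ⇐ (D1) ∧ (D4) ∧ CAP+tail; G-an2-4 gates asym, D1 and NE2/3/4.

WHY THIS FILE.  Every Combes–Thomas engine in the tree carries ONE GLOBAL coercivity constant:
`AccretiveCombesThomas.norm_inv_apply_le` (`m`), `Beta.CombesThomasFormOp.combesThomas_form_op` (`σ`),
`CovariantTowerDecayCT.entry_le_tower` (`σ_k` of pv21's tower — NOT uniform in the number of levels),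
`T4Continuum.CTWeightedCoercivity.WCoercive` (`γw`).  The multi-region averaged operator of
[Balaban1985BackgroundPropagators] (3.24) p. 394 is coercive only LOCALLY, with a constant of order (local block
side)⁻² on each region `Λ_j` (co-owner beta-d4-p2's `MultiscaleCoercive.multiscale_coercive_scaled`, p226432: a
level-count-free `Σ_cells κ₀ n_k⁻²‖f‖²_cell ≤ ⟨f, levelOp f⟩`), and Thm 3.1 p. 397 states the decay of its inverse with
LOCAL prefactors (powers of `L^jη` at the two arguments) times `e^{−δ₀ d(y,y′)}` in a scale-adapted metric, «constants
depending on d, L only».  The mechanism that turns a site-local coercivity profile into a local-prefactor decay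
bound is this file; the weight `ρ`, the metric and the cells are the INSTANCE's data (the MODEL crew's successor node;
pv21 `B9Thm37GlueTorusCovCT.dPart_ge` ∕ `qPart_ge` are the global-constant model defects to be localised there).

CONTENT (all [folklore]; `ι` a finite index type; currency of `AccretiveCombesThomas`: `conjForm A κ ρ z =
Σ_{e,e′} z̄_e e^{κ(ρ_e − ρ_{e′})} A(e,e′) z_{e′}`, `nsq z = Σ_e ‖z_e‖²`; hypothesis SHAPES written out, no `Prop`-valued
definitions — «`A` is locally conjugated-coercive with profile `μ` at `(κ, ρ)`» = `∀ z, Σ_e μ_e‖z_e‖² ≤ Re conjForm A κ ρ z`).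
* §1 DIAGONAL RESCALING `dscale D A (e,e′) = D_e·A(e,e′)·D_{e′}` (`D` real): `conjForm (dscale D A) κ ρ z =
  conjForm A κ ρ (D·z)` (real diagonal matrices commute with the conjugation), `dscale_mulVec`, and
  `(dscale D A)⁻¹ = dscale D⁻¹ A⁻¹` for zero-free `D`.
* §2 LOCAL ⟹ UNIT: if `Σ_e μ_e‖z_e‖² ≤ Re conjForm A κ ρ z` for all `z` with `μ_e > 0`, then `dscale μ^{−1/2} A` is
  conjugated-coercive with constant `1` (`conjCoercive_dscale_of_local`).
* §3 ENDs: `isUnit_of_localConjCoercive`; the LOCAL weighted solution bound `local_solution_bound`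
  (`Σ_e μ_e‖e^{κρ_e}x_e‖² ≤ Σ_e μ_e⁻¹‖e^{κρ_e}v_e‖²` for `Ax = v`); the pairing bound `combesThomas_local`
  (`|u^*x| ≤ e^{−κR}·‖u/√μ‖·‖v/√μ‖`, supports as in `combesThomas_of_conjCoercive`); and
  **`norm_inv_apply_le_local`**: `‖A⁻¹(i,j)‖ ≤ e^{−κ d(i,j)} / √(μ_i μ_j)` — `AccretiveCombesThomas.norm_inv_apply_le`
  BY NAME on the rescaled kernel with `m = 1` (with a constant profile `μ ≡ m` it IS that theorem: `e^{−κd}/√(m·m)`).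
  For the multi-region operator with local coercivity `κ₀/n(e)²` and a scale-adapted
  weight the END reads `|A⁻¹(x,y)| ≤ n(x)·n(y)·e^{−κ d(x,y)}/const` — (3.42)'s local-prefactor shape at the ENTRY ∕ ℓ²-pairing level ONLY — print's (3.42) is a sup-norm operator bound with ONE prefactor `(L^jη)²` at the target and the source in sup norm over a cube `Δ(y′)`, and the entry → sup transfer is NOT level-free; the level-free statement for such consumers is the ℓ²-pairing bound `combesThomas_local`, the local `ℓ² → ℓ^∞` step being O.2 item (ii) (v1.0.1 DOCFIX, d4-p3 XREAD C-d4p3-28 INFO-1) (file 2,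
  `norm_inv_apply_le_of_scaleAdapted`, makes the scale bookkeeping explicit).

ABSOLUTE RULE.  Nothing printed is cited as a fact; no manuscript statement enters as a hypothesis; (3.24) ∕ (3.42) ∕
Thm 3.1 of [Balaban1985BackgroundPropagators] are LOCATORS of the shape only.  Nothing of Bałaban's operators is
instantiated; no weight, metric or cell geometry is constructed here (instance data).  Declarations of the lineage's
`AccretiveCombesThomas` and of b05's `B5Prop11Lower` are used BY NAME, never restated.  Row D4: an abstract engine
for O.2 item (v)'s decay half; class of (T3) ∕ NODE O.2 UNCHANGED (critical-path width 0); D4 DISCHARGE NO DATE; NOT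
BetaPertH, NOT continuum, NOT Clay, NOT summit progress.  References (method only): J.-M. Combes, L. Thomas, Commun.
Math. Phys. 34 (1973) 251–270; S. Agmon, *Lectures on exponential decay of solutions of second-order elliptic
equations*, Princeton 1982.
-/

open scoped BigOperators Matrix ComplexConjugate
open Finset Complex Matrix

namespace Summit.QuantumFields.BalabanUV.Beta.MultiscaleCombesThomas

open Summit.QuantumFields.BalabanUV.Beta.AccretiveCombesThomas
open Literature.MathematicalPhysics.QuantumFieldTheory.Balaban1983to89.B5Prop11Lower (nsq nsq_nonneg
  norm_star_dotProduct_le)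
open Summit.QuantumFields.BalabanUV.T4Continuum.RegionGaugeSliceOrth (le_of_le_sqrt_mul_sqrt)

noncomputable section

variable {ι : Type*} [Fintype ι]

/-! ## §1 Diagonal rescaling of a kernel -/

/-- The two-sided real diagonal rescaling `dscale D A = diag(D)·A·diag(D)`, entrywise
`(dscale D A)(e,e′) = D_e·A(e,e′)·D_{e′}`. [folklore] -/
def dscale (D : ι → ℝ) (A : Matrix ι ι ℂ) : Matrix ι ι ℂ :=
  fun e e' => ((D e : ℝ) : ℂ) * A e e' * ((D e' : ℝ) : ℂ)

omit [Fintype ι] in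
/-- Entries of the rescaled kernel. [folklore] -/
theorem dscale_apply (D : ι → ℝ) (A : Matrix ι ι ℂ) (e e' : ι) :
    dscale D A e e' = ((D e : ℝ) : ℂ) * A e e' * ((D e' : ℝ) : ℂ) := rfl

/-- `dscale D A = diagonal D * A * diagonal D`. [folklore] -/
theorem dscale_eq_diagonal_mul [DecidableEq ι] (D : ι → ℝ) (A : Matrix ι ι ℂ) :
    dscale D A = diagonal (fun e => ((D e : ℝ) : ℂ)) * A * diagonal (fun e => ((D e : ℝ) : ℂ)) := by
  ext e e'
  rw [mul_diagonal, diagonal_mul, dscale_apply]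

omit [Fintype ι] in
/-- Rescalings compose pointwise. [folklore] -/
theorem dscale_dscale (D D' : ι → ℝ) (A : Matrix ι ι ℂ) :
    dscale D (dscale D' A) = dscale (fun e => D e * D' e) A := by
  ext e e'
  simp only [dscale_apply]
  push_cast
  ring

omit [Fintype ι] in
/-- Rescaling by `1` does nothing. [folklore] -/
theorem dscale_one_left (A : Matrix ι ι ℂ) : dscale (fun _ => (1 : ℝ)) A = A := by
  ext e e'
  simp [dscale_apply]

/-- **Real diagonal matrices commute with the conjugation**: the conjugated form of the rescaled kernel at `z` is
the conjugated form of the kernel at the rescaled vector `D·z`. [folklore] -/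
theorem conjForm_dscale (D : ι → ℝ) (A : Matrix ι ι ℂ) (κ : ℝ) (ρ : ι → ℝ) (z : ι → ℂ) :
    conjForm (dscale D A) κ ρ z = conjForm A κ ρ (fun e => ((D e : ℝ) : ℂ) * z e) := by
  unfold conjForm
  refine Finset.sum_congr rfl fun e _ => Finset.sum_congr rfl fun e' _ => ?_
  rw [dscale_apply, map_mul, Complex.conj_ofReal]
  ring

/-- The squared norm of a real-rescaled vector: `‖D·z‖² = Σ_e D_e²‖z_e‖²`. [folklore] -/
theorem nsq_real_mul (D : ι → ℝ) (z : ι → ℂ) :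
    nsq (fun e => ((D e : ℝ) : ℂ) * z e) = ∑ e, D e ^ 2 * ‖z e‖ ^ 2 := by
  unfold nsq
  refine Finset.sum_congr rfl fun e _ => ?_
  rw [norm_mul, Complex.norm_real, Real.norm_eq_abs, mul_pow, sq_abs]

/-- The action of the rescaled kernel: `(dscale D A)·y = D·(A·(D·y))`. [folklore] -/
theorem dscale_mulVec (D : ι → ℝ) (A : Matrix ι ι ℂ) (y : ι → ℂ) :
    dscale D A *ᵥ y = fun e => ((D e : ℝ) : ℂ) * (A *ᵥ fun e' => ((D e' : ℝ) : ℂ) * y e') e := by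
  funext e
  simp only [Matrix.mulVec, dotProduct, dscale_apply, Finset.mul_sum]
  exact Finset.sum_congr rfl fun e' _ => by ring

/-- The inverse of a zero-free real diagonal matrix (read in `ℂ`). [folklore] -/
theorem diagonal_ofReal_inv [DecidableEq ι] (D : ι → ℝ) (hD : ∀ e, D e ≠ 0) :
    (diagonal fun e => ((D e : ℝ) : ℂ))⁻¹ = diagonal fun e => (((D e)⁻¹ : ℝ) : ℂ) := by
  refine Matrix.inv_eq_left_inv ?_
  rw [diagonal_mul_diagonal]
  convert diagonal_one with e
  have h : ((D e : ℝ) : ℂ) ≠ 0 := by exact_mod_cast hD e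
  push_cast
  exact inv_mul_cancel₀ h

/-- **The inverse of the rescaled kernel**: `(dscale D A)⁻¹ = dscale D⁻¹ A⁻¹` for zero-free `D`. [folklore] -/
theorem dscale_inv [DecidableEq ι] (D : ι → ℝ) (hD : ∀ e, D e ≠ 0) (A : Matrix ι ι ℂ) :
    (dscale D A)⁻¹ = dscale (fun e => (D e)⁻¹) A⁻¹ := by
  rw [dscale_eq_diagonal_mul, Matrix.mul_inv_rev, Matrix.mul_inv_rev, diagonal_ofReal_inv D hD,
    dscale_eq_diagonal_mul, Matrix.mul_assoc]

/-- Entries of the inverse of the rescaled kernel. [folklore] -/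
theorem dscale_inv_apply [DecidableEq ι] (D : ι → ℝ) (hD : ∀ e, D e ≠ 0) (A : Matrix ι ι ℂ) (i j : ι) :
    (dscale D A)⁻¹ i j = (((D i)⁻¹ : ℝ) : ℂ) * A⁻¹ i j * (((D j)⁻¹ : ℝ) : ℂ) := by
  rw [dscale_inv D hD, dscale_apply]

/-! ## §2 Local conjugated coercivity ⟹ unit conjugated coercivity of the `μ^{−1/2}`-rescaled kernel -/

omit [Fintype ι] in
/-- The weight `μ^{−1/2}` has no zeros. [folklore] -/
theorem inv_sqrt_ne_zero {μ : ι → ℝ} (hμ : ∀ e, 0 < μ e) (e : ι) : (Real.sqrt (μ e))⁻¹ ≠ 0 :=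
  inv_ne_zero (Real.sqrt_pos.mpr (hμ e)).ne'

/-- **Local ⟹ unit.**  If the conjugated form of `A` dominates the site-dependent mass `Σ_e μ_e‖z_e‖²`, `μ_e > 0`,
then the rescaled kernel `dscale μ^{−1/2} A` is conjugated-coercive with constant `1`. [folklore] -/
theorem conjCoercive_dscale_of_local {A : Matrix ι ι ℂ} {κ : ℝ} {ρ : ι → ℝ} {μ : ι → ℝ} (hμ : ∀ e, 0 < μ e)
    (hc : ∀ z : ι → ℂ, ∑ e, μ e * ‖z e‖ ^ 2 ≤ (conjForm A κ ρ z).re) (z : ι → ℂ) :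
    1 * nsq z ≤ (conjForm (dscale (fun e => (Real.sqrt (μ e))⁻¹) A) κ ρ z).re := by
  rw [conjForm_dscale, one_mul]
  refine le_trans (le_of_eq ?_) (hc _)
  unfold nsq
  refine Finset.sum_congr rfl fun e _ => ?_
  rw [norm_mul, Complex.norm_real, Real.norm_eq_abs, abs_inv, abs_of_nonneg (Real.sqrt_nonneg _), mul_pow,
    inv_pow, Real.sq_sqrt (hμ e).le]
  field_simp [(hμ e).ne']

/-! ## §3 ENDs: invertibility, the local solution bound, the pairing bound, the entrywise bound -/

/-- **Invertibility from local conjugated coercivity** (`μ_e > 0` at every site). [folklore] -/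
theorem isUnit_of_localConjCoercive [DecidableEq ι] {A : Matrix ι ι ℂ} {κ : ℝ} {ρ : ι → ℝ} {μ : ι → ℝ}
    (hμ : ∀ e, 0 < μ e) (hc : ∀ z : ι → ℂ, ∑ e, μ e * ‖z e‖ ^ 2 ≤ (conjForm A κ ρ z).re) : IsUnit A := by
  have h1 : IsUnit (dscale (fun e => (Real.sqrt (μ e))⁻¹) A) :=
    isUnit_of_conjCoercive one_pos (conjCoercive_dscale_of_local hμ hc)
  have hdet := (Matrix.isUnit_iff_isUnit_det _).mp h1
  rw [dscale_eq_diagonal_mul, det_mul, det_mul] at hdet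
  exact (Matrix.isUnit_iff_isUnit_det A).mpr (isUnit_of_mul_isUnit_right (isUnit_of_mul_isUnit_left hdet))

/-- **The LOCAL weighted solution bound.**  If `A` is locally conjugated-coercive with profile `μ > 0` at `(κ, ρ)` and
`Ax = v`, then the weighted unknown `z = e^{κρ}x` and data `w = e^{κρ}v` satisfy `Σ_e μ_e‖z_e‖² ≤ Σ_e μ_e⁻¹‖w_e‖²`
(weighted Cauchy–Schwarz on `Re z^*w`). [folklore] -/
theorem local_solution_bound {A : Matrix ι ι ℂ} {κ : ℝ} {ρ : ι → ℝ} {μ : ι → ℝ} (hμ : ∀ e, 0 < μ e)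
    (hc : ∀ z : ι → ℂ, ∑ e, μ e * ‖z e‖ ^ 2 ≤ (conjForm A κ ρ z).re) {x v : ι → ℂ} (hx : A *ᵥ x = v) :
    ∑ e, μ e * ‖((Real.exp (κ * ρ e) : ℝ) : ℂ) * x e‖ ^ 2 ≤
      ∑ e, (μ e)⁻¹ * ‖((Real.exp (κ * ρ e) : ℝ) : ℂ) * v e‖ ^ 2 := by
  set z : ι → ℂ := fun e => ((Real.exp (κ * ρ e) : ℝ) : ℂ) * x e with hz
  set w : ι → ℂ := fun e => ((Real.exp (κ * ρ e) : ℝ) : ℂ) * v e with hw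
  -- the rescaled pair `√μ·z`, `w/√μ`
  set z' : ι → ℂ := fun e => ((Real.sqrt (μ e) : ℝ) : ℂ) * z e with hz'
  set w' : ι → ℂ := fun e => (((Real.sqrt (μ e))⁻¹ : ℝ) : ℂ) * w e with hw'
  have hquad : conjForm A κ ρ z = star z ⬝ᵥ w := by rw [hz, conjForm_weighted, hx]
  have hpair : star z ⬝ᵥ w = star z' ⬝ᵥ w' := by
    simp only [dotProduct, hz', hw', Pi.star_apply, Complex.star_def, map_mul, Complex.conj_ofReal]
    refine Finset.sum_congr rfl fun e _ => ?_
    have h : ((Real.sqrt (μ e) : ℝ) : ℂ) ≠ 0 := by exact_mod_cast (Real.sqrt_pos.mpr (hμ e)).ne'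
    push_cast
    field_simp
  have hS : nsq z' = ∑ e, μ e * ‖z e‖ ^ 2 := by
    rw [hz', nsq_real_mul]
    exact Finset.sum_congr rfl fun e _ => by rw [Real.sq_sqrt (hμ e).le]
  have hT : nsq w' = ∑ e, (μ e)⁻¹ * ‖w e‖ ^ 2 := by
    rw [hw', nsq_real_mul]
    exact Finset.sum_congr rfl fun e _ => by rw [inv_pow, Real.sq_sqrt (hμ e).le]
  have hle : ∑ e, μ e * ‖z e‖ ^ 2 ≤ Real.sqrt (∑ e, μ e * ‖z e‖ ^ 2) * Real.sqrt (∑ e, (μ e)⁻¹ * ‖w e‖ ^ 2) := by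
    calc ∑ e, μ e * ‖z e‖ ^ 2 ≤ (conjForm A κ ρ z).re := hc z
      _ = (star z' ⬝ᵥ w').re := by rw [hquad, hpair]
      _ ≤ ‖star z' ⬝ᵥ w'‖ := Complex.re_le_norm _
      _ ≤ Real.sqrt (nsq z') * Real.sqrt (nsq w') := norm_star_dotProduct_le z' w'
      _ = _ := by rw [hS, hT]
  have hSnn : 0 ≤ ∑ e, μ e * ‖z e‖ ^ 2 := Finset.sum_nonneg fun e _ => mul_nonneg (hμ e).le (sq_nonneg _)
  have hTnn : 0 ≤ ∑ e, (μ e)⁻¹ * ‖w e‖ ^ 2 :=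
    Finset.sum_nonneg fun e _ => mul_nonneg (inv_nonneg.mpr (hμ e).le) (sq_nonneg _)
  exact le_of_le_sqrt_mul_sqrt hSnn hTnn hle

/-- **The site-local Combes–Thomas pairing bound.**  Local conjugated coercivity with profile `μ > 0` at `(κ, ρ)`,
`κ ≥ 0`, `Ax = v` with `v` supported in `{ρ ≤ 0}` and `u` in `{R ≤ ρ}` give
`|u^*x| ≤ e^{−κR}·√(Σ_e ‖u_e‖²/μ_e)·√(Σ_e ‖v_e‖²/μ_e)` — `AccretiveCombesThomas.combesThomas_of_conjCoercive` BY NAME on the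
rescaled kernel. [folklore] -/
theorem combesThomas_local {A : Matrix ι ι ℂ} (ρ : ι → ℝ) {κ R : ℝ} {μ : ι → ℝ} (hμ : ∀ e, 0 < μ e) (hκ : 0 ≤ κ)
    (hc : ∀ z : ι → ℂ, ∑ e, μ e * ‖z e‖ ^ 2 ≤ (conjForm A κ ρ z).re) {u v x : ι → ℂ} (hx : A *ᵥ x = v)
    (hu : ∀ e, u e ≠ 0 → R ≤ ρ e) (hv : ∀ e, v e ≠ 0 → ρ e ≤ 0) :
    ‖star u ⬝ᵥ x‖ ≤ Real.exp (-(κ * R)) *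
      (Real.sqrt (∑ e, (μ e)⁻¹ * ‖u e‖ ^ 2) * Real.sqrt (∑ e, (μ e)⁻¹ * ‖v e‖ ^ 2)) := by
  set D : ι → ℝ := fun e => (Real.sqrt (μ e))⁻¹ with hD
  have hD0 : ∀ e, D e ≠ 0 := inv_sqrt_ne_zero hμ
  have hDc : ∀ e, ((D e : ℝ) : ℂ) ≠ 0 := fun e => by exact_mod_cast hD0 e
  -- rescaled data
  set x' : ι → ℂ := fun e => (((D e)⁻¹ : ℝ) : ℂ) * x e with hx'
  set v' : ι → ℂ := fun e => ((D e : ℝ) : ℂ) * v e with hv'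
  set u' : ι → ℂ := fun e => ((D e : ℝ) : ℂ) * u e with hu'
  have hx'' : dscale D A *ᵥ x' = v' := by
    rw [dscale_mulVec]
    funext e
    have hDx : (fun e' => ((D e' : ℝ) : ℂ) * x' e') = x := by
      funext e'
      simp only [hx']
      push_cast
      field_simp [hDc e']
    rw [hDx, hx]
  have hu'' : ∀ e, u' e ≠ 0 → R ≤ ρ e := fun e he => hu e (by
    intro h0; apply he; simp [hu', h0])
  have hv'' : ∀ e, v' e ≠ 0 → ρ e ≤ 0 := fun e he => hv e (by
    intro h0; apply he; simp [hv', h0])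
  have h := combesThomas_of_conjCoercive (dscale D A) ρ one_pos hκ (conjCoercive_dscale_of_local hμ hc) hx'' hu'' hv''
  have hpair : star u' ⬝ᵥ x' = star u ⬝ᵥ x := by
    simp only [dotProduct, hu', hx', Pi.star_apply, Complex.star_def, map_mul, Complex.conj_ofReal]
    refine Finset.sum_congr rfl fun e _ => ?_
    push_cast
    field_simp [hDc e]
  have hnu : nsq u' = ∑ e, (μ e)⁻¹ * ‖u e‖ ^ 2 := by
    rw [hu', nsq_real_mul]
    exact Finset.sum_congr rfl fun e _ => by rw [hD, inv_pow, Real.sq_sqrt (hμ e).le]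
  have hnv : nsq v' = ∑ e, (μ e)⁻¹ * ‖v e‖ ^ 2 := by
    rw [hv', nsq_real_mul]
    exact Finset.sum_congr rfl fun e _ => by rw [hD, inv_pow, Real.sq_sqrt (hμ e).le]
  rw [hpair, div_one, hnu, hnv] at h
  exact h

/-- **The site-local entrywise bound — exponential decay with LOCAL PREFACTORS.**  If for every column index `j`
the conjugated form of `A` along `ρ = d(·, j)` (rate `κ ≥ 0`) dominates the SAME site-dependent mass profile
`μ > 0`, and `d(j,j) = 0`, then `‖A⁻¹(i,j)‖ ≤ e^{−κ d(i,j)} / √(μ_i μ_j)`.  For the multi-region operator with local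
coercivity `κ₀/n(e)²` and a scale-adapted weight this is (3.42)'s local-prefactor shape AT THE ENTRY LEVEL (see the header
on the sup-norm transfer): `n(i)·n(j)·e^{−κ d(i,j)}/const`; with a
constant profile `μ ≡ m` it is `AccretiveCombesThomas.norm_inv_apply_le` verbatim (`e^{−κd}/√(m·m) = e^{−κd}/m`).
[cite: Balaban1985BackgroundPropagators, Thm 3.1 (3.42) p.397] [folklore] -/
theorem norm_inv_apply_le_local [DecidableEq ι] (A : Matrix ι ι ℂ) (d : ι → ι → ℝ) (hd0 : ∀ j, d j j = 0)
    {κ : ℝ} {μ : ι → ℝ} (hκ : 0 ≤ κ) (hμ : ∀ e, 0 < μ e)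
    (hc : ∀ j, ∀ z : ι → ℂ, ∑ e, μ e * ‖z e‖ ^ 2 ≤ (conjForm A κ (fun e => d e j) z).re) (i j : ι) :
    ‖A⁻¹ i j‖ ≤ Real.exp (-(κ * d i j)) / Real.sqrt (μ i * μ j) := by
  set D : ι → ℝ := fun e => (Real.sqrt (μ e))⁻¹ with hD
  have hD0 : ∀ e, D e ≠ 0 := inv_sqrt_ne_zero hμ
  have h := norm_inv_apply_le (dscale D A) d hd0 hκ one_pos
    (fun j z => conjCoercive_dscale_of_local hμ (hc j) z) i j
  rw [dscale_inv_apply D hD0, div_one] at h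
  have hi : 0 < Real.sqrt (μ i) := Real.sqrt_pos.mpr (hμ i)
  have hj : 0 < Real.sqrt (μ j) := Real.sqrt_pos.mpr (hμ j)
  have hnorm : ‖((((D i)⁻¹ : ℝ)) : ℂ) * A⁻¹ i j * ((((D j)⁻¹ : ℝ)) : ℂ)‖ = Real.sqrt (μ i) * ‖A⁻¹ i j‖ * Real.sqrt (μ j) := by
    rw [norm_mul, norm_mul, Complex.norm_real, Complex.norm_real, hD]
    simp only [inv_inv, Real.norm_eq_abs, abs_of_pos hi, abs_of_pos hj]
  rw [hnorm] at h
  rw [Real.sqrt_mul (hμ i).le, le_div_iff₀ (mul_pos hi hj)]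
  calc ‖A⁻¹ i j‖ * (Real.sqrt (μ i) * Real.sqrt (μ j)) = Real.sqrt (μ i) * ‖A⁻¹ i j‖ * Real.sqrt (μ j) := by ring
    _ ≤ Real.exp (-(κ * d i j)) := h

end

end Summit.QuantumFields.BalabanUV.Beta.MultiscaleCombesThomas
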